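import Literature.AlgebraicGeometry.GroupSchemes.AffineGroupSchemeBaseChangePoints
import HarnessLib

/-!
# `Γ(G_{R′}, 𝒪) ≃ₐ[R′] R′ ⊗_R Γ(G, 𝒪)` for an affine group scheme — the explicit isomorphism (Görtz–Wedhorn I (4.7), II §(27.2))

Layer `Literature/AlgebraicGeometry/GroupSchemes`, namespace `Literature.AlgebraicGeometry.GroupSchemes.AffineGroupScheme` (continues ★
`AffineGroupSchemeBaseChangePoints` p844891 ∕ ED. 2 p845023 — `algHomEquivBaseChange : (Alg G_{R′} →ₐ[R′] R″) ≃ (Alg G →ₐ[R] R″)`, natural in `R″`,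
the YONEDA form of the identification).  Two `instance`s on the carrier `Alg G_{R′}` (its `R`-algebra structure through `R → R′` and the scalar
tower — ★ `Alg` pattern, own carrier), DEFINITIONS (`toAlgBaseChange`, `algBaseChangeHom`, `algBaseChangeInv`, `algBaseChangeEquiv`) + theorems;
no notation, no named fact, no `sorry`.  Cell `hodgecm-mathlib` (D-0151), programme P6 «MOD», HEART organ GAP-1 clause (GAP-1b, explicit form —
banked by B-p04 (g36) as «NOT DONE»; rider (b) step 1 of B-p04 (g37): base change of the Cartier dual needs `Γ(G_{R′}) ≅ R′ ⊗ Γ(G)` explicitly).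
Count-neutral Mathlib-side capital: HC_CM is proved only modulo the 7 printed citations until rung 0 closes; nothing here bears on it.

THE PRINT ([GortzWedhorn2020] (4.7.1), (4.15); [GortzWedhorn2023] §(27.2)): `Γ(G ×_{Spec R} Spec R′, 𝒪) = R′ ⊗_R Γ(G, 𝒪)` for affine `G`.  Here it
is DERIVED from the Yoneda form by evaluating at the two universal test algebras:

* §1 `Alg.instAlgebraRestrict` (`R`-algebra structure on `Γ(G_{R′})` through `R → R′`), `Alg.instIsScalarTowerRestrict`;
  **`toAlgBaseChange := algHomEquivBaseChange (𝟙) : Γ(G) →ₐ[R] Γ(G_{R′})`** (the universal `R`-algebra map), `algHomEquivBaseChange_eq`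
  (`algHomEquivBaseChange φ = φ|_R ∘ toAlgBaseChange` — Yoneda);
* §2 **`algBaseChangeHom : Γ(G_{R′}) →ₐ[R′] R′ ⊗_R Γ(G)`** (`:= algHomEquivBaseChange⁻¹ (includeRight)`), **`algBaseChangeInv : R′ ⊗_R Γ(G) →ₐ[R′] Γ(G_{R′})`**
  (`:= lift (ofId R′) toAlgBaseChange`), `algBaseChangeHom_comp_toAlgBaseChange`, `algBaseChangeInv_comp_algBaseChangeHom`,
  `algBaseChangeHom_comp_algBaseChangeInv`;
* §3 HEAD **`algBaseChangeEquiv R′ G : Alg G_{R′} ≃ₐ[R′] R′ ⊗[R] Alg G`** (+ `_apply`, `_symm_apply`, `algBaseChangeEquiv_symm_tmul`).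

NOT here: the Hopf-algebra compatibility of `algBaseChangeEquiv` (Yoneda form ★ `algHomEquivBaseChange_mul`), base change of the Cartier dual.

## References
* [GortzWedhorn2020] U. Görtz, T. Wedhorn, *Algebraic Geometry I*, 2nd ed. (2020), (4.7.1) (p. 108), (4.15) (p. 116).
* [GortzWedhorn2023] U. Görtz, T. Wedhorn, *Algebraic Geometry II* (2023), §(27.2) (pp. 606–607).
-/

set_option autoImplicit false

-- Mathlib's `Over`/`Scheme` APIs are stated across semireducible wrappers (as in the ★ `GroupSchemes/*` files).
set_option backward.isDefEq.respectTransparency false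

universe u

open CategoryTheory CategoryTheory.Limits AlgebraicGeometry MonoidalCategory CartesianMonoidalCategory TensorProduct WithConv

noncomputable section

namespace Literature.AlgebraicGeometry.GroupSchemes

namespace AffineGroupScheme

open scoped MonObj CategoryTheory.Obj

open Literature.AlgebraicGeometry.Motives Literature.NumberTheory.DiophantineGeometry

variable {R : Type u} [CommRing R] (R' : Type u) [CommRing R'] [Algebra R R'] (G : SchemeOver R) [GrpObj G] [IsAffine G.left]
  [IsAffine ((Over.pullback (Spec.map (CommRingCat.ofHom (algebraMap R R')))).obj G).left]

/-! ## §1 `Γ(G_{R′})` as an `R`-algebra; the universal map `Γ(G) → Γ(G_{R′})` -/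

/-- `Γ(G_{R′}, 𝒪)` as an `R`-algebra through `R → R′ → Γ(G_{R′})` (an instance on the ★ carrier `Alg` at the base change only).
[cite: GortzWedhorn2020, Section (4.7), (4.7.1) (p. 108)] -/
instance Alg.instAlgebraRestrict : Algebra R (Alg ((Over.pullback (Spec.map (CommRingCat.ofHom (algebraMap R R')))).obj G)) :=
  ((algebraMap R' (Alg ((Over.pullback (Spec.map (CommRingCat.ofHom (algebraMap R R')))).obj G))).comp (algebraMap R R')).toAlgebra

/-- The scalar tower `R → R′ → Γ(G_{R′}, 𝒪)`. [cite: GortzWedhorn2020, Section (4.7), (4.7.1) (p. 108)] -/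
instance Alg.instIsScalarTowerRestrict : IsScalarTower R R' (Alg ((Over.pullback (Spec.map (CommRingCat.ofHom (algebraMap R R')))).obj G)) :=
  IsScalarTower.of_algebraMap_eq fun _ => rfl

/-- **The universal `R`-algebra map `Γ(G) → Γ(G_{R′})`**: the image of `id_{Γ(G_{R′})}` under ★ `algHomEquivBaseChange` (the algebra map of the
projection `G_{R′} → G`). [cite: GortzWedhorn2020, Section (4.7), (4.7.1) (p. 108)] -/
def toAlgBaseChange : Alg G →ₐ[R] Alg ((Over.pullback (Spec.map (CommRingCat.ofHom (algebraMap R R')))).obj G) :=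
  algHomEquivBaseChange R' (Alg ((Over.pullback (Spec.map (CommRingCat.ofHom (algebraMap R R')))).obj G)) G (AlgHom.id R' _)

/-- **Yoneda**: `algHomEquivBaseChange φ = φ|_R ∘ toAlgBaseChange` for every `R′`-algebra map `φ : Γ(G_{R′}) → R″` (★ naturality
`algHomEquivBaseChange_comp` at `id`). [cite: GortzWedhorn2023, §(27.2) (pp. 606–607)] -/
theorem algHomEquivBaseChange_eq {R'' : Type u} [CommRing R''] [Algebra R R''] [Algebra R' R''] [IsScalarTower R R' R'']
    (φ : Alg ((Over.pullback (Spec.map (CommRingCat.ofHom (algebraMap R R')))).obj G) →ₐ[R'] R'') :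
    algHomEquivBaseChange R' R'' G φ = (φ.restrictScalars R).comp (toAlgBaseChange R' G) := by
  rw [toAlgBaseChange, ← algHomEquivBaseChange_comp, AlgHom.comp_id]

/-! ## §2 The two maps `Γ(G_{R′}) ⇄ R′ ⊗_R Γ(G)` -/

/-- **`Γ(G_{R′}) → R′ ⊗_R Γ(G)`**: the `R′`-algebra map corresponding, under ★ `algHomEquivBaseChange`, to `a ↦ 1 ⊗ a`.
[cite: GortzWedhorn2023, §(27.2) (pp. 606–607)] -/
def algBaseChangeHom : Alg ((Over.pullback (Spec.map (CommRingCat.ofHom (algebraMap R R')))).obj G) →ₐ[R'] R' ⊗[R] Alg G :=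
  (algHomEquivBaseChange R' (R' ⊗[R] Alg G) G).symm Algebra.TensorProduct.includeRight

/-- `algBaseChangeHom|_R ∘ toAlgBaseChange = (a ↦ 1 ⊗ a)`. [cite: GortzWedhorn2023, §(27.2) (pp. 606–607)] -/
theorem algBaseChangeHom_comp_toAlgBaseChange :
    ((algBaseChangeHom R' G).restrictScalars R).comp (toAlgBaseChange R' G) =
      (Algebra.TensorProduct.includeRight : Alg G →ₐ[R] R' ⊗[R] Alg G) := by
  rw [← algHomEquivBaseChange_eq, algBaseChangeHom, Equiv.apply_symm_apply]

/-- **`R′ ⊗_R Γ(G) → Γ(G_{R′})`**: `r ⊗ a ↦ r · toAlgBaseChange a` (Mathlib `Algebra.TensorProduct.lift`).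
[cite: GortzWedhorn2023, §(27.2) (pp. 606–607)] -/
def algBaseChangeInv : R' ⊗[R] Alg G →ₐ[R'] Alg ((Over.pullback (Spec.map (CommRingCat.ofHom (algebraMap R R')))).obj G) :=
  Algebra.TensorProduct.lift (Algebra.ofId R' _) (toAlgBaseChange R' G) fun _ _ => .all _ _

/-- `algBaseChangeInv (r ⊗ a) = r · toAlgBaseChange a`. [cite: GortzWedhorn2023, §(27.2) (pp. 606–607)] -/
theorem algBaseChangeInv_tmul (r : R') (a : Alg G) :
    algBaseChangeInv R' G (r ⊗ₜ a) = algebraMap R' _ r * toAlgBaseChange R' G a :=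
  Algebra.TensorProduct.lift_tmul _ _ _ r a

/-- `algBaseChangeInv|_R ∘ (a ↦ 1 ⊗ a) = toAlgBaseChange`. [cite: GortzWedhorn2023, §(27.2) (pp. 606–607)] -/
theorem algBaseChangeInv_comp_includeRight :
    ((algBaseChangeInv R' G).restrictScalars R).comp Algebra.TensorProduct.includeRight = toAlgBaseChange R' G :=
  Algebra.TensorProduct.lift_comp_includeRight _ _ _

/-- **`algBaseChangeInv ∘ algBaseChangeHom = id`** (both sides have the same image `toAlgBaseChange` under the Yoneda bijection).
[cite: GortzWedhorn2023, §(27.2) (pp. 606–607)] -/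
theorem algBaseChangeInv_comp_algBaseChangeHom : (algBaseChangeInv R' G).comp (algBaseChangeHom R' G) = AlgHom.id R' _ := by
  apply (algHomEquivBaseChange R' (Alg ((Over.pullback (Spec.map (CommRingCat.ofHom (algebraMap R R')))).obj G)) G).injective
  rw [algHomEquivBaseChange_eq, algHomEquivBaseChange_eq]
  ext a
  have h := AlgHom.congr_fun (algBaseChangeHom_comp_toAlgBaseChange R' G) a
  simp only [AlgHom.coe_comp, AlgHom.coe_restrictScalars', Function.comp_apply, Algebra.TensorProduct.includeRight_apply] at h
  change algBaseChangeInv R' G (algBaseChangeHom R' G (toAlgBaseChange R' G a)) = toAlgBaseChange R' G a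
  rw [h, algBaseChangeInv_tmul, map_one, one_mul]

/-- **`algBaseChangeHom ∘ algBaseChangeInv = id`** (checked on `r ⊗ a`: `r · algBaseChangeHom (toAlgBaseChange a) = r · (1 ⊗ a)`).
[cite: GortzWedhorn2023, §(27.2) (pp. 606–607)] -/
theorem algBaseChangeHom_comp_algBaseChangeInv : (algBaseChangeHom R' G).comp (algBaseChangeInv R' G) = AlgHom.id R' _ := by
  apply Algebra.TensorProduct.ext'
  intro r a
  have h := AlgHom.congr_fun (algBaseChangeHom_comp_toAlgBaseChange R' G) a
  simp only [AlgHom.coe_comp, AlgHom.coe_restrictScalars', Function.comp_apply, Algebra.TensorProduct.includeRight_apply] at h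
  rw [AlgHom.comp_apply, algBaseChangeInv_tmul, map_mul, AlgHom.commutes, h, AlgHom.id_apply, Algebra.TensorProduct.algebraMap_apply,
    Algebra.TensorProduct.tmul_mul_tmul, mul_one, one_mul, Algebra.algebraMap_self, RingHom.id_apply]

/-! ## §3 The isomorphism -/

/-- **HEAD — `Γ(G_{R′}, 𝒪) ≃ₐ[R′] R′ ⊗_R Γ(G, 𝒪)`** for an affine `R`-scheme `G` and a commutative `R`-algebra `R′`
([GortzWedhorn2020] (4.7.1): global sections of an affine base change). [cite: GortzWedhorn2020, Section (4.7), (4.7.1) (p. 108)] -/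
def algBaseChangeEquiv : Alg ((Over.pullback (Spec.map (CommRingCat.ofHom (algebraMap R R')))).obj G) ≃ₐ[R'] R' ⊗[R] Alg G :=
  AlgEquiv.ofAlgHom (algBaseChangeHom R' G) (algBaseChangeInv R' G) (algBaseChangeHom_comp_algBaseChangeInv R' G)
    (algBaseChangeInv_comp_algBaseChangeHom R' G)

/-- `algBaseChangeEquiv` is `algBaseChangeHom` on elements. [cite: GortzWedhorn2020, Section (4.7), (4.7.1) (p. 108)] -/
theorem algBaseChangeEquiv_apply (x : Alg ((Over.pullback (Spec.map (CommRingCat.ofHom (algebraMap R R')))).obj G)) :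
    algBaseChangeEquiv R' G x = algBaseChangeHom R' G x := rfl

/-- `algBaseChangeEquiv.symm` is `algBaseChangeInv` on elements. [cite: GortzWedhorn2020, Section (4.7), (4.7.1) (p. 108)] -/
theorem algBaseChangeEquiv_symm_apply (y : R' ⊗[R] Alg G) : (algBaseChangeEquiv R' G).symm y = algBaseChangeInv R' G y := rfl

/-- `algBaseChangeEquiv.symm (r ⊗ a) = r · toAlgBaseChange a`. [cite: GortzWedhorn2020, Section (4.7), (4.7.1) (p. 108)] -/
theorem algBaseChangeEquiv_symm_tmul (r : R') (a : Alg G) :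
    (algBaseChangeEquiv R' G).symm (r ⊗ₜ a) = algebraMap R' _ r * toAlgBaseChange R' G a :=
  algBaseChangeInv_tmul R' G r a

/-- `algBaseChangeEquiv (toAlgBaseChange a) = 1 ⊗ a`. [cite: GortzWedhorn2020, Section (4.7), (4.7.1) (p. 108)] -/
theorem algBaseChangeEquiv_toAlgBaseChange (a : Alg G) : algBaseChangeEquiv R' G (toAlgBaseChange R' G a) = 1 ⊗ₜ a := by
  have h := AlgHom.congr_fun (algBaseChangeHom_comp_toAlgBaseChange R' G) a
  simp only [AlgHom.coe_comp, AlgHom.coe_restrictScalars', Function.comp_apply, Algebra.TensorProduct.includeRight_apply] at h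
  rw [algBaseChangeEquiv_apply, h]

end AffineGroupScheme

end Literature.AlgebraicGeometry.GroupSchemes

end
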